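import Mathlib
import HarnessLib
import Summits.AtomisticToContinuum.FouriersLaw.Theses.JunctionLocality
import Summits.AtomisticToContinuum.FouriersLaw.Theorems.JunctionLocalitySuperadditiveResistanceStubKuboFrameAbelian
import Summits.AtomisticToContinuum.FouriersLaw.Theorems.JunctionLocalityConductanceLowerBoundRelocForwardFieldOfResolventBound

/-!
# Mean-ergodic lemma for the relocated equilibrium generators
(helper `helper_relocMeanErgodic` toward stub `stub_contactFormation_resolvent` (R4λ) of line
`cold-bath-relocation-walk`, crux stmt-AtomisticToContinuum-11749 `JunctionLocality.ConductanceLowerBound`;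
`--supports` stmt-AtomisticToContinuum-11749)

Setting: ONE `L`-site pinned anharmonic chain `P = pinnedChain ω₂ lam β γ` (`ω₂ > 0`, `lam, β ≥ 0`, `γ > 0`), its
Gibbs state `μ_T` (`T > 0`), and the operators `L = σ X_H + γ (S_0 + S_m) = σ X_H + γ S_B` on `L²(μ_T)`
(`X_H = liouvilleOp P L`, `S_s = thermo L s T`, `B = 𝟙_{i=0} + 𝟙_{i=m}`, any `σ ≠ 0`, any `m`).  For RESOLVENT
solutions `u ∈ C² ∩ L²(μ_T)` of `λ u − L u = φ` (`λ > 0`, `φ ∈ L²(μ_T)`):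

  `λ ⟨u, k⟩_{μ_T} → ⟨φ⟩_{μ_T} ⟨k⟩_{μ_T}` as `λ → 0⁺`, for every `k ∈ L²(μ_T)`, UNIFORMLY over all solutions `u`

(`λ(λ − L)⁻¹ → 𝔼_{μ_T}` weakly: the mean ergodic theorem in Abelian form; the constants are the kernel of `L` and
of `L^†` by the landed `L²(μ_T)`-Liouville theorem).  Proof (no semigroup, no compactness; adapted from the landed
device version `ThermaliseThenCutProbeInsertion.helper_resolventWeakAbelian`):
* `relocME_smul_norm_toLp_le` — the dissipative a-priori bound `‖λ u‖ ≤ ‖φ‖` (fluctuation–dissipation with a mass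
  term, landed `Kubo.resolvent_fd`, and Cauchy–Schwarz);
* `relocME_mass` — the mass identity `λ ∫ u dμ_T = ∫ φ dμ_T` (landed `integral_resolvent_mul_gibbsDensity`);
* `relocME_integral_adjoint_eq_zero` — `∫ (−σ X_H f + γ S_B f) dμ_T = 0` for `f ∈ C²_c` (landed
  `integral_adjointOp_mul_resolvent` against the constant `1`);
* `helper_relocMeanErgodic` (registered) — the centred classes `v_λ = [λ u] − ⟨φ⟩·1` are bounded in `L²(μ_T)`,
  orthogonal to `1`, and `⟨v_λ, −σ X_H f + γ S_B f⟩ = λ(λ⟨u, f⟩ − ⟨φ, f⟩) → 0` on the adjoint range of `C_c^∞`;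
  `ℝ·1 + L^†(C_c^∞)` is DENSE (landed `ae_eq_zero_of_orthogonal_adjointRange`: Hörmander regularity + Liouville);
  an `ε/2` argument finishes.  Uniformity over all solutions `u` at level `λ` is obtained by running the argument
  along the filter of (level, solution) pairs.
No definitions; standard axioms.  References: folklore (mean ergodic theorem, Abelian form).
-/

noncomputable section

open MeasureTheory Filter Topology
open scoped ContDiff InnerProductSpace
open Literature.MathematicalPhysics.KineticTheory.HeatConduction
open Summit.AtomisticToContinuum.FouriersLaw.Theorems.SuperadditiveResistance.DeviceLiouville
  (kin thermo liouvilleOp bathOp)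
open Summit.AtomisticToContinuum.FouriersLaw.Theorems.SuperadditiveResistance.Kubo (resolvent_fd)
open Summit.AtomisticToContinuum.FouriersLaw.Cruxes.SuperadditiveResistance.FloatingProbeBypassLaplacian
  (inner_toLp_left inner_toLp_toLp norm_toLp_sq memLp_two_of_hasCompactSupport continuous_genOp
    hasCompactSupport_genOp)
open Summit.AtomisticToContinuum.FouriersLaw.Cruxes.SuperadditiveResistance.ThermaliseThenCutProbeInsertion
  (genOp_const_fun integral_resolvent_mul_gibbsDensity integral_adjointOp_mul_resolvent
    ae_eq_zero_of_orthogonal_adjointRange)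

namespace Summit.AtomisticToContinuum.FouriersLaw.Cruxes.ConductanceLowerBound.ColdBathRelocationWalk

/-! ## Three identities for resolvent solutions (general site weights) -/

section General

variable {ω₂ lam β : ℝ} {L : ℕ}

/-- **Dissipative a-priori bound.** For `σ X_H u + c S_B u = −(φ − λ u)` (`u ∈ C² ∩ L²(μ_T)`, `φ ∈ L²(μ_T)`, weights
`B ≥ 0`, `c > 0`, `λ > 0`): `λ ‖u‖_{L²(μ_T)} ≤ ‖φ‖_{L²(μ_T)}` — from `∫ u φ = λ‖u‖² + cT Σ_i B_i ‖∂_{p_i}u‖² ≥ λ‖u‖²`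
(landed `Kubo.resolvent_fd`) and Cauchy–Schwarz. [folklore] -/
theorem relocME_smul_norm_toLp_le (hω : 0 < ω₂) (hl : 0 ≤ lam) (hβ : 0 ≤ β) {γ T : ℝ} (hT : 0 < T)
    (B : Fin L → ℝ) (hB : ∀ i, 0 ≤ B i) (σ : ℝ) {c : ℝ} (hc : 0 < c) {l : ℝ} (hlpos : 0 < l)
    {u φ : PhaseSpace L → ℝ} (hu : ContDiff ℝ 2 u) (hu2 : MemLp u 2 ((pinnedChain ω₂ lam β γ).gibbsMeasure L T))
    (hφ2 : MemLp φ 2 ((pinnedChain ω₂ lam β γ).gibbsMeasure L T))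
    (hpde : ∀ x, σ * liouvilleOp (pinnedChain ω₂ lam β γ) L u x + c * bathOp L B T u x = -(φ x - l * u x)) :
    l * ‖hu2.toLp u‖ ≤ ‖hφ2.toLp φ‖ := by
  have _hl0 : 0 ≤ l := hlpos.le
  set P := pinnedChain ω₂ lam β γ with hP
  -- fluctuation–dissipation with a mass term (density form), dissipation dropped
  have hfd := resolvent_fd hω hl hβ L hT B hB σ hc l hu hu2 hφ2 hpde
  have hD : 0 ≤ c * T * ∑ i, B i * ∫ x, partialP i u x ^ 2 * P.gibbsDensity L T x := by
    refine mul_nonneg (mul_nonneg hc.le hT.le) (Finset.sum_nonneg fun i _ => mul_nonneg (hB i) ?_)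
    exact integral_nonneg fun x => mul_nonneg (sq_nonneg _) (P.gibbsDensity_pos L T x).le
  have h1 : l * ∫ x, u x ^ 2 * P.gibbsDensity L T x ≤ ∫ x, u x * φ x * P.gibbsDensity L T x := by linarith
  -- pass to the Gibbs measure
  have hZ : 0 ≤ (∫ x, P.gibbsDensity L T x)⁻¹ :=
    inv_nonneg.2 (integral_nonneg fun x => (P.gibbsDensity_pos L T x).le)
  have h2 : l * ∫ x, u x ^ 2 ∂(P.gibbsMeasure L T) ≤ ∫ x, u x * φ x ∂(P.gibbsMeasure L T) := by
    rw [P.integral_gibbsMeasure, P.integral_gibbsMeasure (fun x => u x * φ x)]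
    calc l * ((∫ x, P.gibbsDensity L T x)⁻¹ * ∫ x, u x ^ 2 * P.gibbsDensity L T x)
        = (∫ x, P.gibbsDensity L T x)⁻¹ * (l * ∫ x, u x ^ 2 * P.gibbsDensity L T x) := by ring
      _ ≤ (∫ x, P.gibbsDensity L T x)⁻¹ * ∫ x, u x * φ x * P.gibbsDensity L T x :=
          mul_le_mul_of_nonneg_left h1 hZ
  -- Cauchy–Schwarz in `L²(μ_T)`
  have h3 : l * ‖hu2.toLp u‖ ^ 2 ≤ ‖hu2.toLp u‖ * ‖hφ2.toLp φ‖ := by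
    rw [norm_toLp_sq]
    refine h2.trans ?_
    rw [← inner_toLp_toLp hu2 hφ2]
    exact (le_abs_self _).trans (abs_real_inner_le_norm _ _)
  rcases (norm_nonneg (hu2.toLp u)).eq_or_lt with h0 | hpos
  · rw [← h0, mul_zero]; exact norm_nonneg _
  · refine le_of_mul_le_mul_right ?_ hpos
    nlinarith [h3]

/-- **Mass identity.** For `σ X_H u + c S_B u = −(φ − λ u)` (`u ∈ C² ∩ L²(μ_T)`, `φ ∈ L²(μ_T)`, `B ≥ 0`, `c > 0`):
`λ ∫ u dμ_T = ∫ φ dμ_T` (the source of an exact pair has mean zero). [folklore] -/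
theorem relocME_mass (hω : 0 < ω₂) (hl : 0 ≤ lam) (hβ : 0 ≤ β) {γ T : ℝ} (hT : 0 < T)
    (B : Fin L → ℝ) (hB : ∀ i, 0 ≤ B i) (σ : ℝ) {c : ℝ} (hc : 0 < c) (l : ℝ)
    {u φ : PhaseSpace L → ℝ} (hu : ContDiff ℝ 2 u) (hu2 : MemLp u 2 ((pinnedChain ω₂ lam β γ).gibbsMeasure L T))
    (hφ2 : MemLp φ 2 ((pinnedChain ω₂ lam β γ).gibbsMeasure L T))
    (hpde : ∀ x, σ * liouvilleOp (pinnedChain ω₂ lam β γ) L u x + c * bathOp L B T u x = -(φ x - l * u x)) :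
    l * ∫ x, u x ∂((pinnedChain ω₂ lam β γ).gibbsMeasure L T) =
      ∫ x, φ x ∂((pinnedChain ω₂ lam β γ).gibbsMeasure L T) := by
  have h := integral_resolvent_mul_gibbsDensity hω hl hβ L hT B hB σ hc l hu hu2 hφ2 hpde
  rw [(pinnedChain ω₂ lam β γ).integral_gibbsMeasure, (pinnedChain ω₂ lam β γ).integral_gibbsMeasure φ, ← h]
  ring

/-- **The adjoint range is orthogonal to constants.** For `f ∈ C²_c`, any weights `B` and any `σ, c`:
`∫ (−σ X_H f + c S_B f) dμ_T = 0` (the `μ_T`-adjoint identity against the constant `1`, which `σ X_H + c S_B`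
kills). [folklore] -/
theorem relocME_integral_adjoint_eq_zero (hω : 0 < ω₂) (hl : 0 ≤ lam) (hβ : 0 ≤ β) (γ : ℝ) (L : ℕ) {T : ℝ}
    (hT : 0 < T) (B : Fin L → ℝ) (σ c : ℝ) {f : PhaseSpace L → ℝ} (hf : ContDiff ℝ 2 f)
    (hfc : HasCompactSupport f) :
    ∫ x, (-σ * liouvilleOp (pinnedChain ω₂ lam β γ) L f x + c * bathOp L B T f x + 0 * f x)
      ∂((pinnedChain ω₂ lam β γ).gibbsMeasure L T) = 0 := by
  haveI : IsProbabilityMeasure ((pinnedChain ω₂ lam β γ).gibbsMeasure L T) :=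
    pinnedChain_isProbabilityMeasure_gibbsMeasure hω hl hβ γ L hT
  have hpde : ∀ x, σ * liouvilleOp (pinnedChain ω₂ lam β γ) L (fun _ => (1 : ℝ)) x +
      c * bathOp L B T (fun _ => (1 : ℝ)) x =
        -((fun _ : PhaseSpace L => (0 : ℝ)) x - 0 * (fun _ : PhaseSpace L => (1 : ℝ)) x) := by
    intro x
    rw [genOp_const_fun]
    simp
  have h := integral_adjointOp_mul_resolvent hω hl hβ L hT B σ c 0 hf hfc contDiff_const (memLp_const 1)
    (memLp_const 0) hpde
  simpa using h

end General

/-! ## The mean-ergodic lemma -/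

/-- **Registered helper `helper_relocMeanErgodic` (toward R4λ `stub_contactFormation_resolvent`, line
`cold-bath-relocation-walk`): `λ(λ − L)⁻¹ → 𝔼_{μ_T}` weakly, for `L = σ X_H + γ(S_0 + S_m)` on `L²(μ_T)`.**
For `pinnedChain ω₂ lam β γ` (`ω₂ > 0`, `lam, β ≥ 0`, `γ > 0`), `T > 0`, `L ≥ 1`, any `m`, `σ ≠ 0`, a smooth
`φ ∈ L²(μ_T)` and `k ∈ L²(μ_T)`: for every `ε > 0` there is `λ₀ > 0` such that for all `λ ∈ (0, λ₀)` and ALL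
`C² ∩ L²(μ_T)` solutions `u` of `λ u − (σ X_H u + γ(S_0 u + S_m u)) = φ`:
`|λ ∫ u k dμ_T − (∫ φ dμ_T)(∫ k dμ_T)| < ε`. [folklore] -/
theorem helper_relocMeanErgodic : ∀ (ω₂ lam β γ T : ℝ), 0 < ω₂ → 0 ≤ lam → 0 ≤ β → 0 < γ → 0 < T → ∀ (L m : ℕ), 0 < L → ∀ (σ : ℝ), σ ≠ 0 → ∀ (φ k : PhaseSpace L → ℝ), ContDiff ℝ ∞ φ → MemLp φ 2 ((pinnedChain ω₂ lam β γ).gibbsMeasure L T) → MemLp k 2 ((pinnedChain ω₂ lam β γ).gibbsMeasure L T) → ∀ ε : ℝ, 0 < ε → ∃ l₀ : ℝ, 0 < l₀ ∧ ∀ (l : ℝ), 0 < l → l < l₀ → ∀ u : PhaseSpace L → ℝ, ContDiff ℝ 2 u → MemLp u 2 ((pinnedChain ω₂ lam β γ).gibbsMeasure L T) → (∀ x, l * u x - (σ * liouvilleOp (pinnedChain ω₂ lam β γ) L u x + γ * (thermo L 0 T u x + thermo L m T u x)) = φ x) → |l * ∫ x, u x * k x ∂((pinnedChain ω₂ lam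 β γ).gibbsMeasure L T) - (∫ x, φ x ∂((pinnedChain ω₂ lam β γ).gibbsMeasure L T)) * ∫ x, k x ∂((pinnedChain ω₂ lam β γ).gibbsMeasure L T)| < ε := by
  intro ω₂ lam β γ T hω hl hβ hγ hT L m hL σ hσ φ k _ hφ2 hk2 ε hε
  classical
  -- ## the setting
  set P := pinnedChain ω₂ lam β γ with hP
  haveI : IsProbabilityMeasure (P.gibbsMeasure L T) :=
    pinnedChain_isProbabilityMeasure_gibbsMeasure hω hl hβ γ L hT
  have hU1 : ContDiff ℝ 1 P.U := pinnedChain_contDiff_U ω₂ lam β γ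
  have hV1 : ContDiff ℝ 1 P.V := pinnedChain_contDiff_V ω₂ lam β γ
  set B : Fin L → ℝ := fun i => (if i.val = 0 then (1 : ℝ) else 0) + (if i.val = m then 1 else 0) with hBdef
  have hB : ∀ i, 0 ≤ B i := fun i => by
    simp only [hBdef]
    split_ifs <;> norm_num
  have hB0 : 0 < B ⟨0, hL⟩ := by
    simp only [hBdef, if_true]
    split_ifs <;> norm_num
  -- ## (level, solution) pairs, and the filter `level → 0⁺`
  set Sol : Set (ℝ × (PhaseSpace L → ℝ)) := {p | 0 < p.1 ∧ ContDiff ℝ 2 p.2 ∧ MemLp p.2 2 (P.gibbsMeasure L T) ∧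
      ∀ x, p.1 * p.2 x - (σ * liouvilleOp P L p.2 x + γ * (thermo L 0 T p.2 x + thermo L m T p.2 x)) = φ x}
    with hSoldef
  have hSol : ∀ p, p ∈ Sol → 0 < p.1 ∧ ContDiff ℝ 2 p.2 ∧ MemLp p.2 2 (P.gibbsMeasure L T) ∧
      ∀ x, p.1 * p.2 x - (σ * liouvilleOp P L p.2 x + γ * (thermo L 0 T p.2 x + thermo L m T p.2 x)) = φ x :=
    fun p hp => by simpa only [hSoldef, Set.mem_setOf_eq] using hp
  have hpair : ∀ p, p ∈ Sol → ∀ x, σ * liouvilleOp P L p.2 x + γ * bathOp L B T p.2 x = -(φ x - p.1 * p.2 x) := by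
    intro p hp x
    have e := (hSol p hp).2.2.2 x
    rw [hBdef, bathOp_twoSite_eq_thermo]
    linarith
  have hL2 : ∀ p, p ∈ Sol → MemLp p.2 2 (P.gibbsMeasure L T) := fun p hp => (hSol p hp).2.2.1
  have hC2 : ∀ p, p ∈ Sol → ContDiff ℝ 2 p.2 := fun p hp => (hSol p hp).2.1
  have hpos : ∀ p, p ∈ Sol → 0 < p.1 := fun p hp => (hSol p hp).1
  set F : Filter (ℝ × (PhaseSpace L → ℝ)) := Filter.comap Prod.fst (𝓝[>] 0) ⊓ 𝓟 Sol with hF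
  have hev : ∀ᶠ p in F, p ∈ Sol := Filter.mem_inf_of_right (Filter.mem_principal_self _)
  have hfst : Tendsto (fun p : ℝ × (PhaseSpace L → ℝ) => p.1) F (𝓝 0) :=
    ((Filter.tendsto_comap (f := Prod.fst) (x := 𝓝[>] (0 : ℝ))).mono_left inf_le_left).mono_right
      nhdsWithin_le_nhds
  -- ## (1) the classes `W p = [λ u]` and the uniform bound `‖λ u‖ ≤ ‖φ‖`
  set R : ℝ := ‖hφ2.toLp φ‖ with hR
  have hRnn : 0 ≤ R := norm_nonneg _
  set W : ℝ × (PhaseSpace L → ℝ) → Lp ℝ 2 (P.gibbsMeasure L T) := fun p =>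
    if h : p ∈ Sol then p.1 • (hL2 p h).toLp p.2 else 0 with hWdef
  have hWpos : ∀ p (hp : p ∈ Sol), W p = p.1 • (hL2 p hp).toLp p.2 := fun p hp => by
    simp only [hWdef]
    rw [dif_pos hp]
  have hW : ∀ p (hp : p ∈ Sol) (ψ : PhaseSpace L → ℝ) (hψ : MemLp ψ 2 (P.gibbsMeasure L T)),
      ⟪W p, hψ.toLp ψ⟫_ℝ = p.1 * ∫ x, p.2 x * ψ x ∂(P.gibbsMeasure L T) := by
    intro p hp ψ hψ
    rw [hWpos p hp, real_inner_smul_left, inner_toLp_toLp]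
  have hWnorm : ∀ p, ‖W p‖ ≤ R := by
    intro p
    by_cases hp : p ∈ Sol
    · rw [hWpos p hp, norm_smul, Real.norm_eq_abs, abs_of_pos (hpos p hp)]
      exact relocME_smul_norm_toLp_le hω hl hβ hT B hB σ hγ (hpos p hp) (hC2 p hp) (hL2 p hp) hφ2 (hpair p hp)
    · simp only [hWdef]
      rw [dif_neg hp, norm_zero]
      exact hRnn
  -- ## the centred classes `V p = [λ u] − ⟨φ⟩·1`
  have h1mem : MemLp (fun _ : PhaseSpace L => (1 : ℝ)) 2 (P.gibbsMeasure L T) := memLp_const 1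
  set a₀ : ℝ := ∫ x, φ x ∂(P.gibbsMeasure L T) with ha₀
  set V : ℝ × (PhaseSpace L → ℝ) → Lp ℝ 2 (P.gibbsMeasure L T) := fun p => W p - a₀ • h1mem.toLp _ with hVdef
  set C₀ : ℝ := R + ‖a₀ • h1mem.toLp (fun _ : PhaseSpace L => (1 : ℝ))‖ with hC₀
  have hC₀nn : 0 ≤ C₀ := add_nonneg hRnn (norm_nonneg _)
  have hVnorm : ∀ p, ‖V p‖ ≤ C₀ := fun p => (norm_sub_le _ _).trans (add_le_add (hWnorm p) le_rfl)
  have hOneψ : ∀ (ψ : PhaseSpace L → ℝ) (hψ : MemLp ψ 2 (P.gibbsMeasure L T)),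
      ⟪a₀ • h1mem.toLp _, hψ.toLp ψ⟫_ℝ = a₀ * ∫ x, ψ x ∂(P.gibbsMeasure L T) := by
    intro ψ hψ
    rw [real_inner_smul_left, inner_toLp_toLp]
    simp only [one_mul]
  have hVψ : ∀ p (hp : p ∈ Sol) (ψ : PhaseSpace L → ℝ) (hψ : MemLp ψ 2 (P.gibbsMeasure L T)),
      ⟪V p, hψ.toLp ψ⟫_ℝ = p.1 * ∫ x, p.2 x * ψ x ∂(P.gibbsMeasure L T) - a₀ * ∫ x, ψ x ∂(P.gibbsMeasure L T) := by
    intro p hp ψ hψ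
    rw [hVdef]
    dsimp only
    rw [inner_sub_left, hW p hp ψ hψ, hOneψ ψ hψ]
  -- ## (2) convergence on constants: `⟨V p, 1⟩ = λ ∫ u − ∫ φ = 0` (mass identity)
  have hOne : Tendsto (fun p => ⟪V p, h1mem.toLp _⟫_ℝ) F (𝓝 0) := by
    refine (tendsto_const_nhds (x := (0 : ℝ))).congr' ?_
    filter_upwards [hev] with p hp
    rw [hVψ p hp _ h1mem]
    have hmass := relocME_mass hω hl hβ hT B hB σ hγ p.1 (hC2 p hp) (hL2 p hp) hφ2 (hpair p hp)
    rw [← hP] at hmass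
    simp only [mul_one, integral_const, smul_eq_mul, probReal_univ, ha₀]
    linarith [hmass]
  -- ## (3) convergence on the adjoint range `−σ X_H f + γ S_B f`, `f ∈ C_c^∞`
  have hNmem : ∀ (f : PhaseSpace L → ℝ), ContDiff ℝ ∞ f → HasCompactSupport f →
      MemLp (fun x => (-σ) * liouvilleOp P L f x + γ * bathOp L B T f x + 0 * f x) 2 (P.gibbsMeasure L T) :=
    fun f hf hfc =>
    memLp_two_of_hasCompactSupport _ (continuous_genOp hU1 hV1 L (-σ) γ 0 B T (hf.of_le (by norm_cast)))
      (hasCompactSupport_genOp L (-σ) γ 0 B T (hf.of_le (by norm_cast)) hfc)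
  have hRange : ∀ (f : PhaseSpace L → ℝ) (hf : ContDiff ℝ ∞ f) (hfc : HasCompactSupport f),
      Tendsto (fun p => ⟪V p, (hNmem f hf hfc).toLp _⟫_ℝ) F (𝓝 0) := by
    intro f hf hfc
    have hf2 : ContDiff ℝ 2 f := hf.of_le (by norm_cast)
    have hfL2 : MemLp f 2 (P.gibbsMeasure L T) := memLp_two_of_hasCompactSupport _ hf.continuous hfc
    have h0 := relocME_integral_adjoint_eq_zero hω hl hβ γ L hT B σ γ hf2 hfc
    rw [← hP] at h0
    -- for a solution: `⟨V p, [L^† f]⟩ = λ ⟨W p, [f]⟩ − λ ∫ f φ`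
    have hformula : ∀ᶠ p in F, ⟪V p, (hNmem f hf hfc).toLp _⟫_ℝ =
        p.1 * ⟪W p, hfL2.toLp f⟫_ℝ - p.1 * ∫ x, f x * φ x ∂(P.gibbsMeasure L T) := by
      filter_upwards [hev] with p hp
      rw [hVψ p hp _ (hNmem f hf hfc), hW p hp _ hfL2]
      have hadj := integral_adjointOp_mul_resolvent hω hl hβ L hT B σ γ p.1 hf2 hfc (hC2 p hp) (hL2 p hp) hφ2
        (hpair p hp)
      have e1 : ∫ x, p.2 x * ((-σ) * liouvilleOp P L f x + γ * bathOp L B T f x + 0 * f x) ∂(P.gibbsMeasure L T) =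
          ∫ x, (-σ * liouvilleOp P L f x + γ * bathOp L B T f x + 0 * f x) * p.2 x ∂(P.gibbsMeasure L T) :=
        integral_congr_ae (ae_of_all _ fun x => by ring)
      have e2 : ∫ x, f x * p.2 x ∂(P.gibbsMeasure L T) = ∫ x, p.2 x * f x ∂(P.gibbsMeasure L T) :=
        integral_congr_ae (ae_of_all _ fun x => by ring)
      simp only [h0, mul_zero, sub_zero]
      rw [e1, hadj, e2]
      ring
    have hlim1 : Tendsto (fun p : ℝ × (PhaseSpace L → ℝ) => p.1 * ⟪W p, hfL2.toLp f⟫_ℝ) F (𝓝 0) := by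
      refine squeeze_zero_norm' (a := fun p : ℝ × (PhaseSpace L → ℝ) => |p.1| * (R * ‖hfL2.toLp f‖)) ?_ ?_
      · filter_upwards with p
        rw [Real.norm_eq_abs, abs_mul]
        refine mul_le_mul_of_nonneg_left ?_ (abs_nonneg _)
        exact (abs_real_inner_le_norm _ _).trans (mul_le_mul_of_nonneg_right (hWnorm p) (norm_nonneg _))
      · simpa using ((continuous_abs.tendsto (0 : ℝ)).comp hfst).mul_const (R * ‖hfL2.toLp f‖)
    have hlim2 : Tendsto (fun p : ℝ × (PhaseSpace L → ℝ) => p.1 * ∫ x, f x * φ x ∂(P.gibbsMeasure L T))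
        F (𝓝 0) := by
      simpa using hfst.mul_const (∫ x, f x * φ x ∂(P.gibbsMeasure L T))
    simpa using (hlim1.sub hlim2).congr' (hformula.mono fun p hp => hp.symm)
  -- ## (4) the dense subspace `span(1, L^†(C_c^∞))` and convergence on it
  set S : Set (Lp ℝ 2 (P.gibbsMeasure L T)) :=
    insert (h1mem.toLp _) {v | ∃ (f : PhaseSpace L → ℝ) (hf : ContDiff ℝ ∞ f)
      (hfc : HasCompactSupport f), v = (hNmem f hf hfc).toLp _} with hSdef
  have hS : ∀ v ∈ S, Tendsto (fun p => ⟪V p, v⟫_ℝ) F (𝓝 0) := by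
    intro v hv
    rcases hv with rfl | ⟨f, hf, hfc, rfl⟩
    · exact hOne
    · exact hRange f hf hfc
  have hspan : ∀ v ∈ Submodule.span ℝ S, Tendsto (fun p => ⟪V p, v⟫_ℝ) F (𝓝 0) := by
    intro v hv
    refine Submodule.span_induction (p := fun v _ => Tendsto (fun p => ⟪V p, v⟫_ℝ) F (𝓝 0))
      (fun v hv => hS v hv) ?_ ?_ ?_ hv
    · exact (tendsto_const_nhds (x := (0 : ℝ))).congr fun p => (inner_zero_right (V p)).symm
    · intro v w _ _ hv hw
      simpa [inner_add_right] using hv.add hw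
    · intro a v _ hv
      simpa [real_inner_smul_right] using hv.const_mul a
  -- density: the orthogonal complement of `span S` is trivial (Hörmander regularity + Liouville)
  have hDorth : (Submodule.span ℝ S)ᗮ = ⊥ := by
    rw [Submodule.eq_bot_iff]
    intro v hv
    have h1 : ⟪h1mem.toLp _, v⟫_ℝ = 0 :=
      Submodule.inner_right_of_mem_orthogonal (Submodule.subset_span (Set.mem_insert _ _)) hv
    have h2 : ∀ (f : PhaseSpace L → ℝ) (hf : ContDiff ℝ ∞ f) (hfc : HasCompactSupport f),
        ⟪(hNmem f hf hfc).toLp _, v⟫_ℝ = 0 := by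
      intro f hf hfc
      have hmemS : (hNmem f hf hfc).toLp _ ∈ S := by
        rw [hSdef]
        exact Set.mem_insert_of_mem _ ⟨f, hf, hfc, rfl⟩
      exact Submodule.inner_right_of_mem_orthogonal (Submodule.subset_span hmemS) hv
    rw [inner_toLp_left] at h1
    simp only [one_mul] at h1
    have horth : ∀ φ' : PhaseSpace L → ℝ, ContDiff ℝ ∞ φ' → HasCompactSupport φ' →
        ∫ x, (-σ * liouvilleOp P L φ' x + γ * bathOp L B T φ' x + 0 * φ' x) * v x ∂(P.gibbsMeasure L T) = 0 := by
      intro φ' hφ' hφ'c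
      have e := h2 φ' hφ' hφ'c
      rw [inner_toLp_left] at e
      exact e
    have hae := ae_eq_zero_of_orthogonal_adjointRange hω hl hβ γ hL hT hσ hγ hB hB0 (Lp.memLp v) h1 horth
    exact Lp.eq_zero_iff_ae_eq_zero.2 hae
  have hdense : (Submodule.span ℝ S).topologicalClosure = ⊤ :=
    Submodule.topologicalClosure_eq_top_iff.2 hDorth
  -- ## (5) `ε/2`: bounded family + convergence on a dense subspace
  have hkcl : hk2.toLp k ∈ closure ((Submodule.span ℝ S : Submodule ℝ (Lp ℝ 2 (P.gibbsMeasure L T))) :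
      Set (Lp ℝ 2 (P.gibbsMeasure L T))) := by
    rw [← Submodule.topologicalClosure_coe, hdense]
    trivial
  have hmain : Tendsto (fun p => ⟪V p, hk2.toLp k⟫_ℝ) F (𝓝 0) := by
    rw [Metric.tendsto_nhds]
    intro ε' hε'
    have hδ : 0 < ε' / (2 * (C₀ + 1)) := by positivity
    obtain ⟨ψ, hψS, hψd⟩ := Metric.mem_closure_iff.1 hkcl _ hδ
    have hψlim := Metric.tendsto_nhds.1 (hspan ψ hψS) (ε' / 2) (by positivity)
    filter_upwards [hψlim] with p hp
    rw [Real.dist_0_eq_abs] at hp ⊢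
    have hsplit : ⟪V p, hk2.toLp k⟫_ℝ = ⟪V p, ψ⟫_ℝ + ⟪V p, hk2.toLp k - ψ⟫_ℝ := by
      rw [inner_sub_right]; ring
    rw [hsplit]
    have hb : |⟪V p, hk2.toLp k - ψ⟫_ℝ| ≤ C₀ * (ε' / (2 * (C₀ + 1))) := by
      refine (abs_real_inner_le_norm _ _).trans ?_
      refine mul_le_mul (hVnorm p) ?_ (norm_nonneg _) hC₀nn
      rw [← dist_eq_norm]
      exact hψd.le
    have hc : C₀ * (ε' / (2 * (C₀ + 1))) < ε' / 2 := by
      rw [show C₀ * (ε' / (2 * (C₀ + 1))) = (ε' / 2) * (C₀ / (C₀ + 1)) by field_simp]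
      have : C₀ / (C₀ + 1) < 1 := by
        rw [div_lt_one (by positivity)]; linarith
      nlinarith
    calc |⟪V p, ψ⟫_ℝ + ⟪V p, hk2.toLp k - ψ⟫_ℝ|
        ≤ |⟪V p, ψ⟫_ℝ| + |⟪V p, hk2.toLp k - ψ⟫_ℝ| := abs_add_le _ _
      _ < ε' / 2 + ε' / 2 := add_lt_add_of_lt_of_le hp (hb.trans hc.le)
      _ = ε' := by ring
  -- ## back to the statement
  have hfin := Metric.tendsto_nhds.1 hmain ε hε
  rw [hF, Filter.eventually_inf_principal, Filter.eventually_comap] at hfin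
  obtain ⟨δ, hδ, hδP⟩ := Metric.eventually_nhds_iff.1 (eventually_nhdsWithin_iff.1 hfin)
  refine ⟨δ, hδ, fun l hl0 hlδ u huC hu2 hres => ?_⟩
  have hsol : (l, u) ∈ Sol := by
    simp only [hSoldef, Set.mem_setOf_eq]
    exact ⟨hl0, huC, hu2, hres⟩
  have hdist : dist l 0 < δ := by rwa [Real.dist_0_eq_abs, abs_of_pos hl0]
  have h := hδP hdist hl0 (l, u) rfl hsol
  rw [Real.dist_0_eq_abs, hVψ _ hsol k hk2] at h
  exact h

end Summit.AtomisticToContinuum.FouriersLaw.Cruxes.ConductanceLowerBound.ColdBathRelocationWalk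

end
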